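import Summits.Ventures.PercRepro.S1CoreCapSpecSpreadFiveBase
import Summits.Ventures.PercRepro.S1CoreCapSpecSpreadFourMain

/-!
# PercRepro — TOWARDS THE INSTANCE `ν = 5` OF THE SPREAD SPEC: SIMPLE 3-POINT LINES, PART 1 — THE TRIANGLE (p1, gen 32)

`proofs/P1-S2-CORANK6.md` §4g. Configurations of simple 3-point lines (weights `1`) of cost `≤ 5` under the spread clause. A **triangle** —
three lines `X, Y, Z` pairwise meeting in three distinct points — has `lineRank 3` and `6` points (`triangle_base`), so (`not_meet_of_cost_three`)
every other line is disjoint from it or inside it (`triangle_other`); a line inside it avoids the three vertices, hence is the unique line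
through the three third points (`triangle_inside_avoid`, `triangle_inside_eq`); the lines disjoint from it are at most `2` (cost `3`); hence
**a configuration with a triangle has at most `6` lines** (`card_le_six_of_triangle`: the `K₄` beside two disjoint lines, the search's maximal
all-simple configuration). Also here: the general form `not_meet_of_cost_three_rank` of the base lemma (base of cost `3` and rank `≤ 4`; a
simple 3-point line with `o` points on it, `1 ≤ o ≤ 2`, `lineRank b + 2 ≤ 4 + o`, is refused), used by part 2. Axioms: standard.
-/

namespace PercRepro

namespace S1

namespace FourCap

variable {β : Type} [DecidableEq β]

section LinesT

variable {w : β → ℕ} {ls : Finset (Finset β)}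
  (hw1 : ∀ L ∈ ls, ∀ v ∈ L, w v = 1)
  (hcard : ∀ L ∈ ls, L.card = 3)
  (h3 : ∀ L ∈ ls, ∀ L' ∈ ls, L ≠ L' → (L ∩ L').card ≤ 1)
  (h4 : ∀ l : List (Finset β), l.Nodup → (∀ L ∈ l, L ∈ ls) → wsum w (unionL l) ≤ 5 + lineRank l)
  (h7 : ∀ l : List (Finset β), l.Nodup → (∀ L ∈ l, L ∈ ls) → lineRank l ≤ 4 → wsum w (unionL l) ≤ lineRank l + 3)

omit [DecidableEq β] in
include hw1 in
/-- With all weights `1`, the weight of a line is its number of points. -/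
theorem wsum_eq_card_simple {L : Finset β} (hL : L ∈ ls) : wsum w L = L.card := by
  unfold wsum
  rw [Finset.card_eq_sum_ones]
  exact Finset.sum_congr rfl (hw1 L hL)

omit [DecidableEq β] in
include hw1 in
/-- The weights are `1` or `2` (they are `1`). -/
theorem h1_of_simple : ∀ L ∈ ls, ∀ v ∈ L, w v = 1 ∨ w v = 2 := fun L hL v hv => Or.inl (hw1 L hL v hv)

omit [DecidableEq β] in
include hw1 hcard in
/-- Every line has `3` points and weight `3 ≤ 5`. -/
theorem h2_of_simple : ∀ L ∈ ls, 3 ≤ L.card ∧ wsum w L ≤ 5 := fun L hL => by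
  rw [wsum_eq_card_simple hw1 hL, hcard L hL]; omega

include hw1 hcard h7 in
/-- **A base of cost `3` and rank `≤ 4` refuses a simple 3-point line with `o` points on it** whenever `lineRank b + 2 − o ≤ 4`
(`1 ≤ o ≤ 2`): the list `Y :: b` has rank bound `lineRank b + 2 − o ≤ 4` and `lineRank b + 6 − o` points, one more than the clause allows. -/
theorem not_meet_of_cost_three_rank {b : List (Finset β)} (hb : b.Nodup) (hbl : ∀ L ∈ b, L ∈ ls)
    (hcost : wsum w (unionL b) = lineRank b + 3) {Y : Finset β} (hY : Y ∈ ls) (hYb : Y ∉ b)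
    (ho1 : 1 ≤ (Y ∩ unionL b).card) (ho2 : (Y ∩ unionL b).card ≤ 2) (hr : lineRank b + 2 ≤ 4 + (Y ∩ unionL b).card) :
    False := by
  have hnd : (Y :: b).Nodup := List.nodup_cons.2 ⟨hYb, hb⟩
  have hmem : ∀ L ∈ Y :: b, L ∈ ls := by
    intro L hL
    rw [List.mem_cons] at hL
    rcases hL with rfl | hL
    · exact hY
    · exact hbl L hL
  obtain ⟨a1, b1, c1, d1⟩ := cost_step w Y b (fun v hv => by rw [hw1 Y hY v hv])
  have hwsd := wsum_sdiff_eq_card hw1 hY (unionL b)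
  have hc := hcard Y hY
  have hrk : lineRank (Y :: b) ≤ 4 := by
    rw [c1]
    have : min (Y \ unionL b).card (2 - min (Y ∩ unionL b).card 2) ≤ 2 - min (Y ∩ unionL b).card 2 := min_le_right _ _
    omega
  have hsp := h7 (Y :: b) hnd hmem hrk
  rw [c1, a1, hcost, hwsd] at hsp
  omega

include hcard h3 in
/-- **The triangle base**: three lines pairwise meeting in three distinct points `c = X ∩ Y`, `a = Y ∩ Z`, `b = X ∩ Z` have
`lineRank [Z, Y, X] = 3` and `6` points. -/
theorem triangle_base {X Y Z : Finset β} (hX : X ∈ ls) (hY : Y ∈ ls) (hZ : Z ∈ ls) (hYX : Y ≠ X) (hZX : Z ≠ X) (hZY : Z ≠ Y)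
    {a b c : β} (hcX : c ∈ X) (hcY : c ∈ Y) (haY : a ∈ Y) (haZ : a ∈ Z) (hbX : b ∈ X) (hbZ : b ∈ Z) (hab : a ≠ b) :
    lineRank [Z, Y, X] = 3 ∧ (unionL [Z, Y, X]).card = 6 := by
  have kX := hcard X hX
  have kY := hcard Y hY
  have kZ := hcard Z hZ
  have iYX : Y ∩ X = {c} := by
    refine Finset.eq_singleton_iff_unique_mem.2 ⟨Finset.mem_inter.2 ⟨hcY, hcX⟩, fun x hx => ?_⟩
    exact Finset.card_le_one.1 (h3 Y hY X hX hYX) x hx c (Finset.mem_inter.2 ⟨hcY, hcX⟩)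
  have iZY : Z ∩ Y = {a} := by
    refine Finset.eq_singleton_iff_unique_mem.2 ⟨Finset.mem_inter.2 ⟨haZ, haY⟩, fun x hx => ?_⟩
    exact Finset.card_le_one.1 (h3 Z hZ Y hY hZY) x hx a (Finset.mem_inter.2 ⟨haZ, haY⟩)
  have iZX : Z ∩ X = {b} := by
    refine Finset.eq_singleton_iff_unique_mem.2 ⟨Finset.mem_inter.2 ⟨hbZ, hbX⟩, fun x hx => ?_⟩
    exact Finset.card_le_one.1 (h3 Z hZ X hX hZX) x hx b (Finset.mem_inter.2 ⟨hbZ, hbX⟩)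
  have iZ : Z ∩ (Y ∪ X) = {a, b} := by
    rw [Finset.inter_union_distrib_left, iZY, iZX]
    rfl
  have cYX : (Y ∩ X).card = 1 := by rw [iYX]; simp
  have cZ : (Z ∩ (Y ∪ X)).card = 2 := by rw [iZ]; exact Finset.card_pair hab
  have sY : (Y \ X).card + (Y ∩ X).card = Y.card := Finset.card_sdiff_add_card_inter _ _
  have sZ : (Z \ (Y ∪ X)).card + (Z ∩ (Y ∪ X)).card = Z.card := Finset.card_sdiff_add_card_inter _ _
  have uYX : (Y ∪ X).card + (Y ∩ X).card = Y.card + X.card := Finset.card_union_add_card_inter _ _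
  have uZ : (Z ∪ (Y ∪ X)).card + (Z ∩ (Y ∪ X)).card = Z.card + (Y ∪ X).card := Finset.card_union_add_card_inter _ _
  simp only [unionL, lineRank, Finset.union_empty, Finset.sdiff_empty, Finset.inter_empty, Finset.card_empty,
    Nat.zero_add]
  rw [show (2 - min 0 2 : ℕ) = 2 by decide, cYX, cZ]
  have : min X.card 2 = 2 := min_eq_right (by omega)
  constructor
  · omega
  · omega

include hw1 hcard h3 h7 in
/-- **Every other line is disjoint from a triangle or inside it** (`not_meet_of_cost_three` on the base `[Z, Y, X]`). -/
theorem triangle_other {X Y Z : Finset β} (hX : X ∈ ls) (hY : Y ∈ ls) (hZ : Z ∈ ls) (hYX : Y ≠ X) (hZX : Z ≠ X) (hZY : Z ≠ Y)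
    {a b c : β} (hcX : c ∈ X) (hcY : c ∈ Y) (haY : a ∈ Y) (haZ : a ∈ Z) (hbX : b ∈ X) (hbZ : b ∈ Z) (hab : a ≠ b)
    {W : Finset β} (hW : W ∈ ls) (hWX : W ≠ X) (hWY : W ≠ Y) (hWZ : W ≠ Z) :
    Disjoint W (unionL [Z, Y, X]) ∨ W ⊆ unionL [Z, Y, X] := by
  obtain ⟨hrank, hcardU⟩ := triangle_base hcard h3 hX hY hZ hYX hZX hZY hcX hcY haY haZ hbX hbZ hab
  by_cases hsub : W ⊆ unionL [Z, Y, X]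
  · exact Or.inr hsub
  left
  rw [Finset.disjoint_iff_inter_eq_empty]
  by_contra hne
  have hpos : 1 ≤ (W ∩ unionL [Z, Y, X]).card := Finset.card_pos.2 (Finset.nonempty_iff_ne_empty.2 hne)
  have hsd : (W \ unionL [Z, Y, X]).card + (W ∩ unionL [Z, Y, X]).card = W.card := Finset.card_sdiff_add_card_inter _ _
  have hoff : 1 ≤ (W \ unionL [Z, Y, X]).card := by
    rw [Nat.one_le_iff_ne_zero, Ne, Finset.card_eq_zero, Finset.sdiff_eq_empty_iff_subset]
    exact hsub
  have hc := hcard W hW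
  have hb : ([Z, Y, X] : List (Finset β)).Nodup := by simp [hYX, hZX, hZY]
  have hbl : ∀ L ∈ ([Z, Y, X] : List (Finset β)), L ∈ ls := by simp [hX, hY, hZ]
  have hwU : wsum w (unionL [Z, Y, X]) = 6 := by
    rw [wsum_unionL_eq_card hw1 _ hbl, hcardU]
  exact not_meet_of_cost_three_rank hw1 hcard h7 hb hbl (by rw [hwU, hrank]) hW (by simp [hWX, hWY, hWZ]) hpos (by omega)
    (by omega)

include hcard h3 in
/-- **A line inside a triangle avoids its vertices**: through the vertex `c = X ∩ Y` it would meet `X` and `Y` only there and carry its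
two other points on `Z`. -/
theorem triangle_inside_avoid {X Y Z : Finset β} (hX : X ∈ ls) (hY : Y ∈ ls) (hZ : Z ∈ ls) {c : β} (hcX : c ∈ X)
    (hcY : c ∈ Y) {W : Finset β} (hW : W ∈ ls) (hWX : W ≠ X) (hWY : W ≠ Y) (hWZ : W ≠ Z)
    (hsub : W ⊆ Z ∪ (Y ∪ X)) : c ∉ W := by
  intro hcW
  have iX : W ∩ X = {c} := by
    refine Finset.eq_singleton_iff_unique_mem.2 ⟨Finset.mem_inter.2 ⟨hcW, hcX⟩, fun x hx => ?_⟩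
    exact Finset.card_le_one.1 (h3 W hW X hX hWX) x hx c (Finset.mem_inter.2 ⟨hcW, hcX⟩)
  have iY : W ∩ Y = {c} := by
    refine Finset.eq_singleton_iff_unique_mem.2 ⟨Finset.mem_inter.2 ⟨hcW, hcY⟩, fun x hx => ?_⟩
    exact Finset.card_le_one.1 (h3 W hW Y hY hWY) x hx c (Finset.mem_inter.2 ⟨hcW, hcY⟩)
  have hsub' : W.erase c ⊆ W ∩ Z := by
    intro x hx
    rw [Finset.mem_erase] at hx
    have hxU := hsub hx.2
    rw [Finset.mem_union, Finset.mem_union] at hxU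
    refine Finset.mem_inter.2 ⟨hx.2, ?_⟩
    rcases hxU with h | h | h
    · exact h
    · exfalso
      have : x ∈ W ∩ Y := Finset.mem_inter.2 ⟨hx.2, h⟩
      rw [iY, Finset.mem_singleton] at this
      exact hx.1 this
    · exfalso
      have : x ∈ W ∩ X := Finset.mem_inter.2 ⟨hx.2, h⟩
      rw [iX, Finset.mem_singleton] at this
      exact hx.1 this
  have h1 := Finset.card_le_card hsub'
  rw [Finset.card_erase_of_mem hcW, hcard W hW] at h1
  have h2 := h3 W hW Z hZ hWZ
  omega

include hcard h3 in
/-- **At most one line inside a triangle**: two of them avoid the three vertices, so both equal the three remaining points. -/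
theorem triangle_inside_eq {X Y Z : Finset β} (hX : X ∈ ls) (hY : Y ∈ ls) (hZ : Z ∈ ls) (hYX : Y ≠ X) (hZX : Z ≠ X) (hZY : Z ≠ Y)
    {a b c : β} (hcX : c ∈ X) (hcY : c ∈ Y) (haY : a ∈ Y) (haZ : a ∈ Z) (hbX : b ∈ X) (hbZ : b ∈ Z) (hab : a ≠ b)
    (hac : a ≠ c) (hbc : b ≠ c) {W W' : Finset β} (hW : W ∈ ls) (hWX : W ≠ X) (hWY : W ≠ Y) (hWZ : W ≠ Z)
    (hsub : W ⊆ unionL [Z, Y, X]) (hW' : W' ∈ ls) (hW'X : W' ≠ X) (hW'Y : W' ≠ Y) (hW'Z : W' ≠ Z)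
    (hsub' : W' ⊆ unionL [Z, Y, X]) : W = W' := by
  obtain ⟨_, hcardU⟩ := triangle_base hcard h3 hX hY hZ hYX hZX hZY hcX hcY haY haZ hbX hbZ hab
  simp only [unionL, Finset.union_empty] at hsub hsub' hcardU
  -- both lines lie in the three non-vertex points
  have hin : ∀ {V : Finset β}, V ∈ ls → V ≠ X → V ≠ Y → V ≠ Z → V ⊆ Z ∪ (Y ∪ X) →
      V ⊆ (Z ∪ (Y ∪ X)) \ {a, b, c} := by
    intro V hV hVX hVY hVZ hVsub x hx
    rw [Finset.mem_sdiff, Finset.mem_insert, Finset.mem_insert, Finset.mem_singleton]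
    refine ⟨hVsub hx, ?_⟩
    rintro (rfl | rfl | rfl)
    · exact triangle_inside_avoid hcard h3 hY hZ hX haY haZ hV hVY hVZ hVX (by
        intro y hy; have := hVsub hy; simp only [Finset.mem_union] at this ⊢; tauto) hx
    · exact triangle_inside_avoid hcard h3 hX hZ hY hbX hbZ hV hVX hVZ hVY (by
        intro y hy; have := hVsub hy; simp only [Finset.mem_union] at this ⊢; tauto) hx
    · exact triangle_inside_avoid hcard h3 hX hY hZ hcX hcY hV hVX hVY hVZ hVsub hx
  have habc : ({a, b, c} : Finset β) ⊆ Z ∪ (Y ∪ X) := by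
    intro x hx
    simp only [Finset.mem_insert, Finset.mem_singleton] at hx
    simp only [Finset.mem_union]
    rcases hx with rfl | rfl | rfl
    · exact Or.inl haZ
    · exact Or.inl hbZ
    · exact Or.inr (Or.inr hcX)
  have hcard3 : ((Z ∪ (Y ∪ X)) \ {a, b, c}).card = 3 := by
    rw [Finset.card_sdiff_of_subset habc, hcardU, Finset.card_insert_of_notMem (by simp [hab, hac]),
      Finset.card_pair hbc]
  have e1 : W = (Z ∪ (Y ∪ X)) \ {a, b, c} :=
    Finset.eq_of_subset_of_card_le (hin hW hWX hWY hWZ hsub) (by rw [hcard3, hcard W hW])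
  have e2 : W' = (Z ∪ (Y ∪ X)) \ {a, b, c} :=
    Finset.eq_of_subset_of_card_le (hin hW' hW'X hW'Y hW'Z hsub') (by rw [hcard3, hcard W' hW'])
  rw [e1, e2]

include hw1 hcard h3 h4 h7 in
/-- **A configuration of simple 3-point lines with a triangle has at most six lines**: the three lines, at most one inside, at most two
disjoint (the base `[Z, Y, X]` has cost `3`). -/
theorem card_le_six_of_triangle {X Y Z : Finset β} (hX : X ∈ ls) (hY : Y ∈ ls) (hZ : Z ∈ ls) (hYX : Y ≠ X) (hZX : Z ≠ X)
    (hZY : Z ≠ Y) {a b c : β} (hcX : c ∈ X) (hcY : c ∈ Y) (haY : a ∈ Y) (haZ : a ∈ Z) (hbX : b ∈ X) (hbZ : b ∈ Z)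
    (hab : a ≠ b) (hac : a ≠ c) (hbc : b ≠ c) : ls.card ≤ 6 := by
  obtain ⟨hrank, hcardU⟩ := triangle_base hcard h3 hX hY hZ hYX hZX hZY hcX hcY haY haZ hbX hbZ hab
  have hb : ([Z, Y, X] : List (Finset β)).Nodup := by simp [hYX, hZX, hZY]
  have hbl : ∀ L ∈ ([Z, Y, X] : List (Finset β)), L ∈ ls := by simp [hX, hY, hZ]
  have hwU : wsum w (unionL [Z, Y, X]) = 6 := by
    rw [wsum_unionL_eq_card hw1 _ hbl, hcardU]
  set 𝓘 := ls.filter (fun L => L ≠ X ∧ L ≠ Y ∧ L ≠ Z ∧ L ⊆ unionL [Z, Y, X]) with h𝓘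
  set 𝓓 := ls.filter (fun L => Disjoint L (unionL [Z, Y, X])) with h𝓓
  have hD : 𝓓.card ≤ 2 :=
    card_filter_disjoint_le_two (h1_of_simple hw1) (h2_of_simple hw1 hcard) h3 h4 hb hbl (by rw [hrank, hwU])
  have hI : 𝓘.card ≤ 1 := by
    refine Finset.card_le_one.2 (fun W hW W' hW' => ?_)
    rw [h𝓘, Finset.mem_filter] at hW hW'
    exact triangle_inside_eq hcard h3 hX hY hZ hYX hZX hZY hcX hcY haY haZ hbX hbZ hab hac hbc hW.1 hW.2.1 hW.2.2.1
      hW.2.2.2.1 hW.2.2.2.2 hW'.1 hW'.2.1 hW'.2.2.1 hW'.2.2.2.1 hW'.2.2.2.2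
  have hcover : ls ⊆ ({X, Y, Z} : Finset (Finset β)) ∪ (𝓘 ∪ 𝓓) := by
    intro W hW
    rw [Finset.mem_union, Finset.mem_union, Finset.mem_insert, Finset.mem_insert, Finset.mem_singleton]
    by_cases hWX : W = X
    · exact Or.inl (Or.inl hWX)
    by_cases hWY : W = Y
    · exact Or.inl (Or.inr (Or.inl hWY))
    by_cases hWZ : W = Z
    · exact Or.inl (Or.inr (Or.inr hWZ))
    rcases triangle_other hw1 hcard h3 h7 hX hY hZ hYX hZX hZY hcX hcY haY haZ hbX hbZ hab hW hWX hWY hWZ with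
      hd | hs
    · exact Or.inr (Or.inr (Finset.mem_filter.2 ⟨hW, hd⟩))
    · exact Or.inr (Or.inl (Finset.mem_filter.2 ⟨hW, hWX, hWY, hWZ, hs⟩))
  have hc := Finset.card_le_card hcover
  have hu1 := Finset.card_union_le ({X, Y, Z} : Finset (Finset β)) (𝓘 ∪ 𝓓)
  have hu2 := Finset.card_union_le 𝓘 𝓓
  have h3' : ({X, Y, Z} : Finset (Finset β)).card ≤ 3 := Finset.card_le_three
  omega

end LinesT

end FourCap

end S1

end PercRepro
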